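import Summits.NavierStokesRegularity.NavierStokesRegularity.Theorems.OddMorawetzOddMorawetzLocalWeightThreeFinal
import Summits.NavierStokesRegularity.NavierStokesRegularity.Theorems.OddMorawetzOddMorawetzLocalWeightFiveFinal
import Summits.NavierStokesRegularity.NavierStokesRegularity.Theorems.OddMorawetzOddMorawetzLocalStructureDensV
import Summits.NavierStokesRegularity.NavierStokesRegularity.Theorems.OddMorawetzOddMorawetzLocalInvariantFixed
import Summits.NavierStokesRegularity.NavierStokesRegularity.Theorems.OddMorawetzMorawetzKillsTypeIIsotropicReduction
import Summits.NavierStokesRegularity.NavierStokesRegularity.Theorems.OddMorawetzMorawetzKillsTypeIReduction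
import Summits.NavierStokesRegularity.NavierStokesRegularity.Theses.OddMorawetz
import HarnessLib

/-!
# Crux `OddMorawetzLocal` (stmt-NavierStokesRegularity-1376) is FALSE

`OddMorawetzLocal` asserts the existence of a local Morawetz certificate: a smooth cubic density `m` on 3-jets of
derivative weight `k ≤ 5` whose Euler derivative `Q(v) = -∫ Dm(Jv)[J B(v,v)]` is `≥ 0` on all divergence-free Schwartz
fields and `> 0` on one. There is none:
* parity and the weight-one analysis leave only odd `k ∈ {3, 5}` (`three_le_of_morawetzCertificate`, item 1377);
* Haar averaging over `O(3)` makes the certificate isotropic (`stub_isotropicReduction`, item 1377);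
* on symmetric jets `m = densV k τ` (`structure_densV`), `τ` is fixed by the action matrices of all orthogonal matrices
  (`actMatrix_fixed_of_invariant`) and `Q(v) = morawetzPairing k v τ` (`neg_integral_fderiv_eq_morawetzPairing`);
* the certified structure theorem (`live_reduction`: B₃ span + rotation derivative + modular rank certificates of the
  derivation system + reconstruction, all kernel-checked) and the null-Lagrangian calculus leave `Q = γ Q_R` (k = 3) or
  `Q = γ_A Q_A + γ_B Q_B` (k = 5), and the kernel-computed exact values of these at explicit odd polynomial-Gaussian
  fields have both signs / a positive exact cancellation (`no_certificate_weight_three/five`), so `Q ≡ 0` — no strict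
  witness.
Closes the item `refuted`. No named facts; axioms `propext`, `Classical.choice`, `Quot.sound`.
-/

noncomputable section

set_option linter.dupNamespace false

namespace Summit.NavierStokesRegularity.NavierStokesRegularity.Theorems

open MeasureTheory Literature.Analysis.FluidPDE Summit.NavierStokesRegularity.NavierStokesRegularity.Theorems.OddMorawetz

/-- **Refutation of the crux `OddMorawetzLocal` (refuted-substantive).** There is no local, odd-cubic Morawetz-type
monotone quantity of derivative weight `≤ 5` for divergence-free fields on `ℝ³`: every candidate that is nonnegative
on all divergence-free Schwartz fields vanishes identically. Witness of falsity: the complete classification above —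
not a missing side condition (every weight `k ≤ 5` is excluded), so no cheap repair of the statement exists. -/
theorem not_OddMorawetzLocal :
    ¬ Summit.NavierStokesRegularity.NavierStokesRegularity.Theses.OddMorawetz.OddMorawetzLocal := by
  intro h
  obtain ⟨k, m, hk5, hm, hcub, hwt, hQ, hpos⟩ := h
  -- only `k = 3` or `k = 5` survive parity and weight one
  have h35 := three_le_of_morawetzCertificate k m hm hcub hwt hQ hpos
  have hk : k = 3 ∨ k = 5 := by
    obtain ⟨⟨j, hj⟩, h3⟩ := h35
    omega
  -- isotropic reduction (Haar average over `O(3)`)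
  obtain ⟨m', hm', hcub', hwt', hinv, hQ', hpos'⟩ := stub_isotropicReduction k m hm hcub hwt hQ hpos
  -- the density on symmetric jets and its fixed coefficient vector
  obtain ⟨τ, hτ⟩ := structure_densV k hm' hcub' hwt'
  have hfix := actMatrix_fixed_of_invariant k τ hτ hinv
  have hnn : ∀ v, IsSchwartzField v → VectorCalculus.IsDivFree v → 0 ≤ morawetzPairing k v τ := by
    intro v hv hd
    have h := hQ' v hv hd
    dsimp only at h
    rwa [neg_integral_fderiv_eq_morawetzPairing k hm' τ hτ v hv hd] at h
  obtain ⟨v₀, hv₀, hd₀, hpos₀⟩ := hpos'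
  have hpos₁ : 0 < morawetzPairing k v₀ τ := by
    have h := hpos₀
    dsimp only at h
    rwa [neg_integral_fderiv_eq_morawetzPairing k hm' τ hτ v₀ hv₀ hd₀] at h
  -- the two finite cases
  rcases hk with rfl | rfl
  · exact absurd (no_certificate_weight_three τ hfix hnn v₀ hv₀ hd₀) (ne_of_gt hpos₁)
  · exact absurd (no_certificate_weight_five τ hfix hnn v₀ hv₀ hd₀) (ne_of_gt hpos₁)

end Summit.NavierStokesRegularity.NavierStokesRegularity.Theorems

end
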